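import Summits.AtomisticToContinuum.HydrodynamicLimit.Theorems.DensityCap.Negative.MollifiedDensity
import Summits.AtomisticToContinuum.HydrodynamicLimit.Theorems.JParityClosureDensityCapCapEventSubset
import Summits.AtomisticToContinuum.HydrodynamicLimit.Theorems.JParityClosureDensityCapEulerDensityModulus
import Literature.MathematicalPhysics.KineticTheory.HardSphereCanonicalTorus
import Literature.Analysis.FluidPDE.HardSpherePhaseSpaceProofs
import HarnessLib

/-!
# The finite-grid upgrade: fixed-time density LLN on `[0, t]` ⇒ the uniform cap (`stub_gridUpgrade`)

Stub E (the measure-theoretic assembly) of the line `lipschitz-clock-free-past-cap` for the crux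
`JParityClosure.DensityCap` (stmt-AtomisticToContinuum-13082). For a flow family `Φ`, laws
`P_N = localGibbsLaw σ a₀ u₀ θ₀ N (Φ N)`, a density field `ρ` and a horizon `t`:

* the MEAN DISPLACEMENT BOUND along good orbits (stub A, `stub_meanDisplacement`, taken as the
  hypothesis `hdisp`) and the `3/(π r⁴)`-Lipschitz bound of the cone kernel in the particle position
  (`gridUp_abs_cone_sub_cone_le`, triangle inequality for the minimal-image distance) give the
  LIPSCHITZ CLOCK `|ρ̄ʳ(Φ_{s'} z)(x₀) − ρ̄ʳ(Φ_s z)(x₀)| ≤ 3/(πr⁴) · √(2K̄(z)) · |s' − s|`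
  (`gridUp_clock`), and the same kernel bound in the centre gives the centre-Lipschitz modulus
  (`gridUp_abs_mollDensity_sub_le_centre`);
* finite nets of `𝕋³` in the minimal-image distance (`gridUp_euclidNet`: compactness of the torus,
  `finite_cover_balls_of_compact`, and `euclidDist ≤ √3 · ‖·‖_∞`, `Torus.euclidDist_le_holds`) and of
  `[0, t]` (`gridUp_timeNet`);
* the sure inclusion at fixed `N` (stub D, `stub_capEventSubset`): on `good ∩ {K̄ ≤ K}` the overshoot
  event lies in the finite union of the grid deviation events;
* the bad set is null (`gridUp_localGibbsLaw_compl_good`: the law is `≪` Liouville), the energy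
  event `{K < K̄}` is negligible by hypothesis (`hK`, the `χ ≡ 1` energy tie), and each grid event is
  negligible by the fixed-time density LLN at `s_k ∈ [0, t]` with the continuous test `cone r · x_l`
  (`hlln`); a finite union bound on the outer measure and `Tendsto ⇒ ∃ N₀` finish.

The statement is `CapLimit σ a₀ u₀ θ₀ Φ ρ t` — verbatim the conclusion block of the crux
(`DensityCapNegative.CapLimit`, `densityCap_iff`). The order of limits is the crux's: `N → ∞` at
FIXED `r` (every constant below depends on `r` through `3/(π r⁴)`), then `r → 0`.

References: H. Spohn, *Large Scale Dynamics of Interacting Particles* (1991), Part I §3 (setting);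
C. Kipnis, C. Landim, *Scaling Limits of Interacting Particle Systems* (1999), Ch. 4 (moduli of
continuity as the route from fixed-time to uniform-in-time statements).
-/

noncomputable section

namespace Summit.AtomisticToContinuum.HydrodynamicLimit.Theorems

open MeasureTheory Filter Set Topology
open scoped ENNReal BigOperators
open Literature.MathematicalPhysics.KineticTheory Literature.Analysis.FluidPDE
open Summit.AtomisticToContinuum.HydrodynamicLimit.Theorems.DensityCapNegative
  (cone mollDensity capEvent CapLimit mollDensity_eq cone_nonneg cone_le)
open Summit.AtomisticToContinuum.HydrodynamicLimit.Theorems.PolynomialCompressionPDE (Flows)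

/-! ## The cone kernel is `3/(π r⁴)`-Lipschitz in the minimal-image distance -/

/-- **Lipschitz bound of the cone kernel in the particle position**: for `r > 0`,
`|b_r(y, x₀) − b_r(y', x₀)| ≤ 3/(π r⁴) · d(y, y')` (the profile `τ ↦ (1 − τ/r)₊` is `1/r`-Lipschitz and
`|d(y, x₀) − d(y', x₀)| ≤ d(y, y')` by the triangle inequality of the minimal-image distance). -/
theorem gridUp_abs_cone_sub_cone_le {r : ℝ} (hr : 0 < r) (y y' x₀ : T3) :
    |cone r y x₀ - cone r y' x₀| ≤ 3 / (Real.pi * r ^ 4) * Torus.euclidDist y y' := by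
  have hc : 0 ≤ 3 / (Real.pi * r ^ 3) := div_nonneg (by norm_num) (by positivity)
  have hd : |Torus.euclidDist y x₀ - Torus.euclidDist y' x₀| ≤ Torus.euclidDist y y' := by
    rw [abs_sub_le_iff]
    constructor
    · have h := euclidDist_triangle y y' x₀
      linarith
    · have h := euclidDist_triangle y' y x₀
      rw [Torus.euclidDist_comm y' y] at h
      linarith
  have hmax : |max (1 - Torus.euclidDist y x₀ / r) 0 - max (1 - Torus.euclidDist y' x₀ / r) 0| ≤
      Torus.euclidDist y y' / r := by
    refine (abs_max_sub_max_le_abs _ _ _).trans ?_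
    rw [show (1 - Torus.euclidDist y x₀ / r) - (1 - Torus.euclidDist y' x₀ / r) =
      -((Torus.euclidDist y x₀ - Torus.euclidDist y' x₀) / r) by ring, abs_neg, abs_div,
      abs_of_pos hr]
    exact div_le_div_of_nonneg_right hd hr.le
  unfold cone
  rw [← mul_sub, abs_mul, abs_of_nonneg hc]
  calc 3 / (Real.pi * r ^ 3) * |max (1 - Torus.euclidDist y x₀ / r) 0 - max (1 - Torus.euclidDist y' x₀ / r) 0|
      ≤ 3 / (Real.pi * r ^ 3) * (Torus.euclidDist y y' / r) := mul_le_mul_of_nonneg_left hmax hc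
    _ = 3 / (Real.pi * r ^ 4) * Torus.euclidDist y y' := by
        field_simp

/-- **Centre-Lipschitz bound of the mollified density**: for every configuration `w`,
`|ρ̄ʳ(w)(x) − ρ̄ʳ(w)(x')| ≤ 3/(π r⁴) · d(x, x')` (average of the kernel bound over the particles). -/
theorem gridUp_abs_mollDensity_sub_le_centre {r : ℝ} (hr : 0 < r) {n : ℕ} (w : Config n (Fin 3) T3)
    (x x' : T3) :
    |mollDensity r w x - mollDensity r w x'| ≤ 3 / (Real.pi * r ^ 4) * Torus.euclidDist x x' := by
  rw [mollDensity_eq, mollDensity_eq, ← mul_sub, ← Finset.sum_sub_distrib, abs_mul,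
    abs_of_nonneg (inv_nonneg.2 (Nat.cast_nonneg n))]
  have hterm : ∀ i, |cone r (w i).1 x - cone r (w i).1 x'| ≤ 3 / (Real.pi * r ^ 4) * Torus.euclidDist x x' := by
    intro i
    rw [densMod_cone_comm r x, densMod_cone_comm r x']
    exact gridUp_abs_cone_sub_cone_le hr x x' (w i).1
  rcases Nat.eq_zero_or_pos n with hn | hn
  · subst hn
    simp only [Nat.cast_zero, inv_zero, zero_mul]
    exact mul_nonneg (div_nonneg (by norm_num) (by positivity)) (norm_nonneg _)
  · have hn' : (0 : ℝ) < n := by exact_mod_cast hn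
    calc (n : ℝ)⁻¹ * |∑ i, (cone r (w i).1 x - cone r (w i).1 x')|
        ≤ (n : ℝ)⁻¹ * ∑ i, |cone r (w i).1 x - cone r (w i).1 x'| :=
          mul_le_mul_of_nonneg_left (Finset.abs_sum_le_sum_abs _ _) (inv_nonneg.2 hn'.le)
      _ ≤ (n : ℝ)⁻¹ * ∑ _i : Fin n, 3 / (Real.pi * r ^ 4) * Torus.euclidDist x x' := by
          gcongr with i _
          exact hterm i
      _ = 3 / (Real.pi * r ^ 4) * Torus.euclidDist x x' := by
          rw [Finset.sum_const, Finset.card_univ, Fintype.card_fin, nsmul_eq_mul, ← mul_assoc,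
            inv_mul_cancel₀ hn'.ne', one_mul]

/-- **The mollified density moves by at most `3/(π r⁴)` times the mean displacement**: for two
configurations `w, w'` of the same particles,
`|ρ̄ʳ(w')(x₀) − ρ̄ʳ(w)(x₀)| ≤ 3/(π r⁴) · n⁻¹ ∑ᵢ d(x'ᵢ, xᵢ)`. -/
theorem gridUp_abs_mollDensity_sub_le_meanDisp {r : ℝ} (hr : 0 < r) {n : ℕ}
    (w' w : Config n (Fin 3) T3) (x₀ : T3) :
    |mollDensity r w' x₀ - mollDensity r w x₀| ≤
      3 / (Real.pi * r ^ 4) * ((n : ℝ)⁻¹ * ∑ i, Torus.euclidDist (w' i).1 (w i).1) := by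
  rw [mollDensity_eq, mollDensity_eq, ← mul_sub, ← Finset.sum_sub_distrib, abs_mul,
    abs_of_nonneg (inv_nonneg.2 (Nat.cast_nonneg n)), mul_left_comm, Finset.mul_sum]
  refine mul_le_mul_of_nonneg_left ((Finset.abs_sum_le_sum_abs _ _).trans ?_)
    (inv_nonneg.2 (Nat.cast_nonneg n))
  exact Finset.sum_le_sum fun i _ => gridUp_abs_cone_sub_cone_le hr (w' i).1 (w i).1 x₀

/-- **The Lipschitz clock from the mean displacement bound.** If along the orbit of `z` the mean
minimal-image displacement between times `s` and `s'` is at most `√(2K̄) · |s' − s|`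
(`K̄ = n⁻¹ · configEnergy z`; stub A), then the `r`-mollified empirical density read at any centre is
Lipschitz in time with constant `3/(π r⁴) · √(2K̄)`. -/
theorem gridUp_clock {ε r : ℝ} (hr : 0 < r) {n : ℕ} (Ψ : HardSphereFlow (Torus.geometry (Fin 3)) ε n)
    {z : Config n (Fin 3) T3}
    (hdisp : ∀ s s' : ℝ, (n : ℝ)⁻¹ * ∑ i, Torus.euclidDist ((Ψ.flow s' z i).1) ((Ψ.flow s z i).1) ≤
      Real.sqrt (2 * ((n : ℝ)⁻¹ * configEnergy z)) * |s' - s|)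
    (s s' : ℝ) (x₀ : T3) :
    |mollDensity r (Ψ.flow s' z) x₀ - mollDensity r (Ψ.flow s z) x₀| ≤
      3 / (Real.pi * r ^ 4) * Real.sqrt (2 * ((n : ℝ)⁻¹ * configEnergy z)) * |s' - s| := by
  have hL : 0 ≤ 3 / (Real.pi * r ^ 4) := div_nonneg (by norm_num) (by positivity)
  calc |mollDensity r (Ψ.flow s' z) x₀ - mollDensity r (Ψ.flow s z) x₀|
      ≤ 3 / (Real.pi * r ^ 4) * ((n : ℝ)⁻¹ * ∑ i, Torus.euclidDist ((Ψ.flow s' z i).1) ((Ψ.flow s z i).1)) :=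
        gridUp_abs_mollDensity_sub_le_meanDisp hr _ _ x₀
    _ ≤ 3 / (Real.pi * r ^ 4) * (Real.sqrt (2 * ((n : ℝ)⁻¹ * configEnergy z)) * |s' - s|) :=
        mul_le_mul_of_nonneg_left (hdisp s s') hL
    _ = _ := by ring

/-! ## Finite nets of `𝕋³` (minimal-image distance) and of `[0, t]` -/

/-- **Finite nets of the torus in the minimal-image distance**: for every `δ > 0` a finite set
`S ⊆ 𝕋³` with every point within minimal-image distance `δ` of `S` (the torus is compact for the
sup-metric, and the minimal-image distance is at most `√3` times the sup-distance,
`Torus.euclidDist_le_holds`). -/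
theorem gridUp_euclidNet {δ : ℝ} (hδ : 0 < δ) :
    ∃ S : Finset T3, ∀ x : T3, ∃ y ∈ S, Torus.euclidDist x y ≤ δ := by
  obtain ⟨T, -, hTfin, hcover⟩ :=
    finite_cover_balls_of_compact (isCompact_univ (X := T3)) (e := δ / 2) (half_pos hδ)
  refine ⟨hTfin.toFinset, fun x => ?_⟩
  have hx := hcover (Set.mem_univ x)
  simp only [Set.mem_iUnion, exists_prop] at hx
  obtain ⟨y, hyT, hxy⟩ := hx
  refine ⟨y, hTfin.mem_toFinset.2 hyT, ?_⟩
  rw [Metric.mem_ball, dist_eq_norm] at hxy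
  have h3 : Real.sqrt (Fintype.card (Fin 3) : ℝ) ≤ 2 := by
    rw [Fintype.card_fin, show ((3 : ℕ) : ℝ) = 3 by norm_num,
      show (2 : ℝ) = Real.sqrt 4 by
        rw [show (4 : ℝ) = 2 ^ 2 by norm_num, Real.sqrt_sq (by norm_num : (0 : ℝ) ≤ 2)]]
    exact Real.sqrt_le_sqrt (by norm_num)
  calc Torus.euclidDist x y ≤ Real.sqrt (Fintype.card (Fin 3) : ℝ) * ‖x - y‖ := Torus.euclidDist_le_holds x y
    _ ≤ 2 * (δ / 2) := mul_le_mul h3 hxy.le (norm_nonneg _) (by norm_num)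
    _ = δ := by ring

/-- **Finite nets of the time interval**: for every `δ > 0` a finite set `S ⊆ [0, t]` with every
`s ∈ [0, t]` within `δ` of `S` (`[0, t]` is compact; empty nets are allowed when `t < 0`). -/
theorem gridUp_timeNet (t : ℝ) {δ : ℝ} (hδ : 0 < δ) :
    ∃ S : Finset ℝ, (∀ s ∈ S, s ∈ Icc 0 t) ∧ ∀ s ∈ Icc 0 t, ∃ s' ∈ S, |s - s'| ≤ δ := by
  obtain ⟨T, hTsub, hTfin, hcover⟩ := finite_cover_balls_of_compact (isCompact_Icc (a := (0 : ℝ)) (b := t)) hδ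
  refine ⟨hTfin.toFinset, fun s hs => hTsub (hTfin.mem_toFinset.1 hs), fun s hs => ?_⟩
  have hx := hcover hs
  simp only [Set.mem_iUnion, exists_prop] at hx
  obtain ⟨s', hs'T, hss'⟩ := hx
  refine ⟨s', hTfin.mem_toFinset.2 hs'T, ?_⟩
  rw [Metric.mem_ball, Real.dist_eq] at hss'
  exact hss'.le

/-! ## The bad set is null for the local Gibbs law -/

/-- The bad set of a flow is null for the local Gibbs law (the law is absolutely continuous with
respect to the Liouville measure, `HardSphereFlow.measure_compl_good`). -/
theorem gridUp_localGibbsLaw_compl_good (σ : ℝ) (a₀ θ₀ : T3 → ℝ) (u₀ : T3 → V3) (N : ℕ)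
    (Ψ : HardSphereFlow (Torus.geometry (Fin 3)) (hsDiameter σ N) (N + 1)) :
    localGibbsLaw σ a₀ u₀ θ₀ N Ψ Ψ.goodᶜ = 0 := by
  have hL : localGibbsLaw σ a₀ u₀ θ₀ N Ψ =
      (liouville (Torus.geometry (Fin 3)) (N + 1) (hsDiameter σ N)).withDensity fun z => ENNReal.ofReal
        (canonicalDensity (Torus.geometry (Fin 3)) (hsDiameter σ N) (N + 1) (localGibbsProfile a₀ u₀ θ₀) z) :=
    rfl
  rw [hL]
  exact withDensity_absolutelyContinuous _ _ Ψ.measure_compl_good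

/-! ## The finite-grid upgrade -/

/-- **STUB E — the finite-grid upgrade** (registered stub `stub_gridUpgrade` of the line
`lipschitz-clock-free-past-cap`). For the flow family `Φ`, the laws `P_N = localGibbsLaw σ a₀ u₀ θ₀ N (Φ N)`,
a field `ρ` and a horizon `t`: the mean displacement bound along good orbits (`hdisp`, stub A per
`N`), tightness `P_N(K < K̄_N) → 0` of the kinetic energy per particle (`hK`), the density modulus of
`ρ` on `[0, t]` (`hmod`, stub B's conclusion) and the fixed-time density law of large numbers at every
`s ∈ [0, t]` (`hlln`) imply the crux's conclusion block `CapLimit σ a₀ u₀ θ₀ Φ ρ t`: for all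
`η, δ > 0` there is `r₀ > 0` such that for every `r ∈ (0, r₀)` eventually in `N` the overshoot event
`{∃ s ∈ [0,t], ∃ x, ρ s x + η < ρ̄ʳ(Φ_N(s) z)(x)}` has `P_N`-measure `≤ δ`. Proof: `r₀, τ₀` from
the modulus at `η/4`; at fixed `r` choose meshes `δx = r₀ ∧ η/(8L)`, `δt = τ₀ ∧ η/(8L(√(2K)+1))`,
`L = 3/(π r⁴)`, finite nets (`gridUp_euclidNet`, `gridUp_timeNet`), the clock (`gridUp_clock`), the
sure inclusion (`stub_capEventSubset`), and bound
`P_N(cap) ≤ ∑_{k,l} P_N(grid_{k,l}) + P_N(goodᶜ) + P_N(K < K̄) → 0`. -/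
theorem stub_gridUpgrade {σ : ℝ} (a₀ θ₀ : T3 → ℝ) (u₀ : T3 → V3) (Φ : Flows σ) (ρ : ℝ → T3 → ℝ)
    (t : ℝ)
    (hdisp : ∀ N : ℕ, ∀ z ∈ (Φ N).good, ∀ s s' : ℝ,
      ((N + 1 : ℕ) : ℝ)⁻¹ * ∑ i, Torus.euclidDist (((Φ N).flow s' z i).1) (((Φ N).flow s z i).1) ≤
        Real.sqrt (2 * (((N + 1 : ℕ) : ℝ)⁻¹ * configEnergy z)) * |s' - s|)
    {K : ℝ}
    (hK : Tendsto (fun N => localGibbsLaw σ a₀ u₀ θ₀ N (Φ N)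
      {z | K < ((N + 1 : ℕ) : ℝ)⁻¹ * configEnergy z}) atTop (𝓝 0))
    (hmod : ∀ η : ℝ, 0 < η → ∃ r₀ : ℝ, 0 < r₀ ∧ r₀ ≤ 1 / 2 ∧
      (∀ r : ℝ, 0 < r → r < r₀ → ∀ s ∈ Icc 0 t, ∀ x : T3, ∫ y, cone r y x * ρ s y ≤ ρ s x + η) ∧
      ∃ τ₀ : ℝ, 0 < τ₀ ∧ ∀ s ∈ Icc 0 t, ∀ s' ∈ Icc 0 t, |s - s'| ≤ τ₀ →
        ∀ x x' : T3, Torus.euclidDist x x' ≤ r₀ → |ρ s x - ρ s' x'| ≤ η)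
    (hlln : ∀ s ∈ Icc 0 t, ∀ χ : T3 → ℝ, Continuous χ → ∀ δ : ℝ, 0 < δ →
      Tendsto (fun N => localGibbsLaw σ a₀ u₀ θ₀ N (Φ N)
        {z | δ < |empiricalDensityField ((Φ N).flow s z) χ - ∫ x, χ x * ρ s x|}) atTop (𝓝 0)) :
    CapLimit σ a₀ u₀ θ₀ Φ ρ t := by
  intro η δ hη hδ
  obtain ⟨r₀, hr₀, -, hmod1, τ₀, hτ₀, hmod2⟩ := hmod (η / 4) (by positivity)
  refine ⟨r₀, hr₀, fun r hr hrr₀ => ?_⟩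
  -- constants at fixed `r`
  set L : ℝ := 3 / (Real.pi * r ^ 4) with hLdef
  have hLpos : 0 < L := by positivity
  set V : ℝ := Real.sqrt (2 * K) with hVdef
  have hV : 0 ≤ V := Real.sqrt_nonneg _
  -- meshes
  set δx : ℝ := min r₀ (η / (8 * L)) with hδxdef
  set δt : ℝ := min τ₀ (η / (8 * L * (V + 1))) with hδtdef
  have hδx : 0 < δx := lt_min hr₀ (by positivity)
  have hδt : 0 < δt := lt_min hτ₀ (by positivity)
  have hδx₁ : δx ≤ r₀ := min_le_left _ _
  have hδx₂ : L * δx ≤ η / 8 := by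
    calc L * δx ≤ L * (η / (8 * L)) := mul_le_mul_of_nonneg_left (min_le_right _ _) hLpos.le
      _ = η / 8 := by field_simp
  have hδt₁ : δt ≤ τ₀ := min_le_left _ _
  have hδt₂ : L * V * δt ≤ η / 8 := by
    calc L * V * δt ≤ L * (V + 1) * δt := by gcongr; linarith
      _ ≤ L * (V + 1) * (η / (8 * L * (V + 1))) :=
          mul_le_mul_of_nonneg_left (min_le_right _ _) (by positivity)
      _ = η / 8 := by field_simp
  -- nets
  obtain ⟨Sx, hSx⟩ := gridUp_euclidNet hδx
  obtain ⟨St, hSt, hSt'⟩ := gridUp_timeNet t hδt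
  -- the grid deviation events and their laws
  set P : (N : ℕ) → Measure (Config (N + 1) (Fin 3) T3) := fun N => localGibbsLaw σ a₀ u₀ θ₀ N (Φ N)
    with hPdef
  set A : (N : ℕ) → ℝ → T3 → Set (Config (N + 1) (Fin 3) T3) := fun N s x =>
    {z | η / 4 < |empiricalDensityField ((Φ N).flow s z) (fun y => cone r y x) - ∫ y, cone r y x * ρ s y|}
    with hAdef
  have hA : ∀ s ∈ St, ∀ x : T3, Tendsto (fun N => P N (A N s x)) atTop (𝓝 0) := by
    intro s hs x
    exact hlln s (hSt s hs) (fun y => cone r y x) (densMod_continuous_cone r x) (η / 4) (by positivity)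
  -- the dominating sequence tends to zero
  set f : ℕ → ℝ≥0∞ := fun N => (∑ s ∈ St, ∑ x ∈ Sx, P N (A N s x)) +
    P N {z | K < ((N + 1 : ℕ) : ℝ)⁻¹ * configEnergy z} with hfdef
  have hf : Tendsto f atTop (𝓝 0) := by
    have hsum : Tendsto (fun N => ∑ s ∈ St, ∑ x ∈ Sx, P N (A N s x)) atTop (𝓝 0) := by
      have h := tendsto_finsetSum St fun s hs => tendsto_finsetSum Sx fun x _ => hA s hs x
      simpa only [Finset.sum_const_zero] using h
    simpa only [add_zero] using hsum.add hK
  -- the overshoot event is dominated by `f N` for every `N`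
  have hdom : ∀ N, P N (capEvent Φ N ρ t η r) ≤ f N := by
    intro N
    have hclock : ∀ z ∈ (Φ N).good, ∀ (s s' : ℝ) (x₀ : T3),
        |mollDensity r ((Φ N).flow s' z) x₀ - mollDensity r ((Φ N).flow s z) x₀| ≤
          3 / (Real.pi * r ^ 4) * Real.sqrt (2 * (((N + 1 : ℕ) : ℝ)⁻¹ * configEnergy z)) * |s' - s| :=
      fun z hz s s' x₀ => gridUp_clock hr (Φ N) (hdisp N z hz) s s' x₀
    have hsub := stub_capEventSubset (Φ N) ρ (t := t) (η := η) (r₀ := r₀) (τ₀ := τ₀) (K := K)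
      (δx := δx) (δt := δt) hr hclock (fun w x x' => gridUp_abs_mollDensity_sub_le_centre hr w x x')
      (hmod1 r hr hrr₀) hmod2 Sx hSx hδx₁ hδx₂ St hSt hSt' hδt₁ hδt₂
    have hcap : capEvent Φ N ρ t η r ⊆
        ((⋃ s ∈ St, ⋃ x ∈ Sx, A N s x) ∪ (Φ N).goodᶜ) ∪ {z | K < ((N + 1 : ℕ) : ℝ)⁻¹ * configEnergy z} := by
      intro z hz
      by_cases hg : z ∈ (Φ N).good
      · by_cases hKz : ((N + 1 : ℕ) : ℝ)⁻¹ * configEnergy z ≤ K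
        · exact Or.inl (Or.inl (hsub ⟨⟨hz, hg⟩, hKz⟩))
        · exact Or.inr (not_le.1 hKz)
      · exact Or.inl (Or.inr hg)
    have hU : P N (⋃ s ∈ St, ⋃ x ∈ Sx, A N s x) ≤ ∑ s ∈ St, ∑ x ∈ Sx, P N (A N s x) :=
      (measure_biUnion_finset_le St fun s => ⋃ x ∈ Sx, A N s x).trans
        (Finset.sum_le_sum fun s _ => measure_biUnion_finset_le Sx fun x => A N s x)
    calc P N (capEvent Φ N ρ t η r)
        ≤ P N (((⋃ s ∈ St, ⋃ x ∈ Sx, A N s x) ∪ (Φ N).goodᶜ) ∪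
            {z | K < ((N + 1 : ℕ) : ℝ)⁻¹ * configEnergy z}) := measure_mono hcap
      _ ≤ P N (⋃ s ∈ St, ⋃ x ∈ Sx, A N s x) + P N (Φ N).goodᶜ +
            P N {z | K < ((N + 1 : ℕ) : ℝ)⁻¹ * configEnergy z} :=
          (measure_union_le _ _).trans (add_le_add (measure_union_le _ _) le_rfl)
      _ ≤ (∑ s ∈ St, ∑ x ∈ Sx, P N (A N s x)) + 0 +
            P N {z | K < ((N + 1 : ℕ) : ℝ)⁻¹ * configEnergy z} :=
          add_le_add (add_le_add hU (le_of_eq (gridUp_localGibbsLaw_compl_good σ a₀ θ₀ u₀ N (Φ N)))) le_rfl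
      _ = f N := by rw [add_zero]
  -- `Tendsto ⇒ ∃ N₀`
  have hev : ∀ᶠ N in atTop, f N < ENNReal.ofReal δ :=
    (tendsto_order.1 hf).2 _ (ENNReal.ofReal_pos.2 hδ)
  obtain ⟨N₀, hN₀⟩ := eventually_atTop.1 hev
  exact ⟨N₀, fun N hN => (hdom N).trans (hN₀ N hN).le⟩

end Summit.AtomisticToContinuum.HydrodynamicLimit.Theorems

end
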